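import Literature.NumberTheory.EllipticCurves.CMNewformOfHeckeCharacter
import Literature.NumberTheory.Automorphic.PairLFunctionBaseChange
import Literature.NumberTheory.LFunctions.RayClassCharacter
import Literature.NumberTheory.LFunctions.IdealNormCount
import Literature.NumberTheory.GaloisRepresentations.HeckeCharacterProofs
import Mathlib.NumberTheory.RamificationInertia.Galois
import Mathlib.NumberTheory.RamificationInertia.Unramified
import Mathlib.NumberTheory.NumberField.Discriminant.Different
import HarnessLib

/-!
# The CM newform of a Hecke character: the Euler-factor bookkeeping (proofs only)

Sibling proof file of `Literature.NumberTheory.EllipticCurves.CMNewformOfHeckeCharacter` (the named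
fact `Ribet1977_cmNewform_of_heckeCharacter`: Ribet, LNM 601 (1977), §3, Thm. (3.4), Cor. (3.5),
Remark (3.5)).  Theorems only — no definition, no named fact (D-0026).

The fact is stated "Euler factor by Euler factor": at a rational prime `p ∤ N` the Hecke polynomial
`X² - a_p(f) X + ε(p) p^{k-1}` of the newform `f` is the induced Frobenius polynomial
`∏_{w ∣ p} (X^{f(w|p)} - ψ(ϖ_w))` of the Hecke character `ψ` (`inducedFrobPolynomial`).  Ribet's
printed statement is in terms of Fourier coefficients: `a_p(f) = ∑_{N𝔞 = p} ψ(𝔞)` (Cor. (3.5)),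
`a_p = 0` if `p` is inert (loc. cit., "`a_p = 0` if `φ(p) = -1`"), character `ε = ηφ` with
`η(p) p^{k-1} = ψ((p))` (§3, p. 34).  This file proves the dictionary between the two shapes, which
is the part of the identity `L(f, s) = L(ψ, s)` (Miyake, *Modular Forms*, Thm. 4.8.2) that is pure
bookkeeping of the places of a quadratic field:

* `ramificationIdxIn_eq_one_of_not_dvd_discr` — a rational prime `p ∤ d_K` is unramified in `K`
  (`e_p = 1`; Dedekind's discriminant theorem, Mathlib `NumberField.not_dvd_discr_iff_forall_mem`),
  the source of the clause "`p` is unramified in `K`" for `p ∤ N = |d_K| N(𝔣)`;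
* `exists_places_eq_pair_or_eq_singleton` — in a quadratic extension `E/F`, above a finite place `v`
  of `F` unramified in `E` there are either two places `w₁ ≠ w₂` of residue degree `1` (split) or
  one place of residue degree `2` (inert) (`#{w ∣ v} · f_v = 2`, Neukirch, *Algebraic Number
  Theory*, Ch. I, (8.2)–(9.2));
* `inducedFrobPolynomial_linear_of_pair`, `inducedFrobPolynomial_linear_of_singleton` — accordingly
  `∏_{w ∣ v} (X^{f(w|v)} - c_w)` is `(X - c_{w₁})(X - c_{w₂})` resp. `X² - c_w`;
* `map_heckePolynomial_eq_mul_linear_iff`, `map_heckePolynomial_eq_X_sq_sub_iff` — for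
  `f ∈ S_k(Γ₁(N))`: `X² - a_p X + ε(p)p^{k-1} = (X - α)(X - β) ↔ a_p = α + β ∧ ε(p)p^{k-1} = αβ`, and
  `= X² - γ ↔ a_p = 0 ∧ ε(p)p^{k-1} = -γ`;
* `absNorm_eq_natGenerator_iff`, `setOf_absNorm_eq_of_pair`, `…_of_singleton` — the ideals of
  prime norm `p` are the primes above `p` of residue degree one: `{𝔞 : N𝔞 = p} = {𝔭, 𝔭̄}` at a
  split prime and `= ∅` at an inert one (Ribet's "no ideal of `F` has norm `p`", p. 35), whence
  `∑_{N𝔞 = p} g(𝔞) = g(𝔭) + g(𝔭̄)` resp. `= 0` (`finsum_mem_setOf_absNorm_eq_of_pair/_of_singleton`);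
* `span_natGenerator_eq_mul_of_pair`, `span_natGenerator_eq_of_singleton` — `(p) = 𝔭 𝔭̄` resp.
  `(p) = 𝔭` in the quadratic field, hence `ψ̃((p)) = ψ̃(𝔭) ψ̃(𝔭̄)` resp. `ψ̃(𝔭)` for the ideal
  character `ψ̃ = idealPow` (`idealPow_span_natGenerator_of_pair/_of_singleton`);
* `map_heckePolynomial_eq_inducedFrobPolynomial_iff_ribet_of_pair`, `…_of_singleton` — the
  Euler-factor clause of the fact in Ribet's printed form: `a_p(f) = ∑_{N𝔞 = p} ψ̃(𝔞)` and
  `ε(p) p^{k-1} = φ(p) ψ̃((p))` (`φ(p) = ±1` split/inert);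
* `Ribet1977_cmNewform_of_heckeCharacter_of_qExpansion` — **assembly**: the fact follows from
  Ribet's printed statement (newform of level `N`, `|d_K| ∣ N`, primes under ramified places of `ψ`
  divide `N`, `a_p(f) = ∑_{N𝔞 = p} ψ̃(𝔞)`, `ε(p) p^{k-1} = ±ψ̃((p))` for `p ∤ N`) by the bookkeeping
  of this file — so a discharge of the fact need only deliver Thm. (3.4) + Cor. (3.5) + Remark (3.5)
  in `q`-expansion form;
* `map_heckePolynomial_eq_inducedFrobPolynomial_iff_of_pair`, `…_of_singleton` — the two combined:
  the Euler-factor clause of `Ribet1977_cmNewform_of_heckeCharacter` at a split prime `p = 𝔭𝔭̄` says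
  exactly `a_p(f) = ψ(ϖ_𝔭) + ψ(ϖ_𝔭̄)` and `ε(p) p^{k-1} = ψ(ϖ_𝔭) ψ(ϖ_𝔭̄)`, and at an inert prime
  `a_p(f) = 0` and `ε(p) p^{k-1} = -ψ(ϖ_{(p)})` (Ribet 1977, Cor. (3.5) with §3, p. 34).

## References

* K. A. Ribet, *Galois representations attached to eigenforms with Nebentypus*, LNM 601 (1977),
  §3, pp. 34–35. [Ribet1977Nebentypus]
* T. Miyake, *Modular Forms* (1989/2006), Thm. 4.8.2. [Miyake2006]
* J. Neukirch, *Algebraic Number Theory* (1999), Ch. I, Prop. (8.2), (9.2); Ch. III §2, Cor. (2.12). [NeukirchANT1999]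
-/

noncomputable section

open scoped NumberField Polynomial ModularForm MatrixGroups
open NumberField IsDedekindDomain Polynomial CongruenceSubgroup UpperHalfPlane
open Literature.NumberTheory.GaloisRepresentations

namespace Literature.NumberTheory.EllipticCurves.ModularForms

/-! ### Rational primes not dividing the discriminant are unramified -/

section Discriminant

variable (K : Type) [Field K] [NumberField K]

/-- **Dedekind's discriminant theorem (the direction used by Ribet's level `N = D M`)**: if the
rational prime `p_v` under the place `v` of `ℚ` does not divide `d_K`, then every prime of `𝓞 K`
above `v` is unramified over `𝓞 ℚ`, so `e_v = Ideal.ramificationIdxIn v (𝓞 K) = 1` (Mathlib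
`NumberField.not_dvd_discr_iff_forall_mem` over `ℤ`, transported to `𝓞 ℚ` by
`Algebra.IsUnramifiedAt.of_restrictScalars`).  No Galois hypothesis: `ramificationIdxIn` is the
index of *some* prime above `v`, and all of them have index `1`.
[cite: NeukirchANT1999, Ch. III §2, Cor. (2.12)] -/
theorem ramificationIdxIn_eq_one_of_not_dvd_discr (v : HeightOneSpectrum (𝓞 ℚ))
    (hnd : ¬ (Rat.HeightOneSpectrum.natGenerator v : ℤ) ∣ NumberField.discr K) :
    v.asIdeal.ramificationIdxIn (𝓞 K) = 1 := by
  classical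
  have hp : Prime (Rat.HeightOneSpectrum.natGenerator v : ℤ) :=
    Nat.prime_iff_prime_int.mp (Rat.HeightOneSpectrum.prime_natGenerator v)
  -- every prime above `v` has ramification index `1`
  have hall : ∀ (P : Ideal (𝓞 K)) [P.IsPrime], P.LiesOver v.asIdeal →
      P.ramificationIdx (𝓞 ℚ) = 1 := by
    intro P _ hP
    have h1 : ((Rat.HeightOneSpectrum.natGenerator v : ℕ) : 𝓞 ℚ) ∈ v.asIdeal :=
      (Rat.natCast_mem_asIdeal_iff v).mpr dvd_rfl
    have h2 : algebraMap (𝓞 ℚ) (𝓞 K) ((Rat.HeightOneSpectrum.natGenerator v : ℕ) : 𝓞 ℚ) ∈ P := by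
      rw [hP.over] at h1
      exact Ideal.mem_comap.mp h1
    rw [map_natCast] at h2
    have hunr := (NumberField.not_dvd_discr_iff_forall_mem K (𝓞 K) hp).mp hnd P ‹_›
      (by exact_mod_cast h2)
    haveI : Algebra.IsUnramifiedAt (𝓞 ℚ) P :=
      Algebra.IsUnramifiedAt.of_restrictScalars (R := ℤ) (A := 𝓞 ℚ) P
    exact Ideal.ramificationIdx_eq_one P (𝓞 ℚ)
  have h : ∃ P : Ideal (𝓞 K), P.IsPrime ∧ P.LiesOver v.asIdeal := by
    obtain ⟨⟨P, hP, hPv⟩⟩ := (inferInstance : Nonempty (v.asIdeal.primesOver (𝓞 K)))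
    exact ⟨P, hP, hPv⟩
  rw [Ideal.ramificationIdxIn, dif_pos h]
  haveI := h.choose_spec.1
  exact hall h.choose h.choose_spec.2

/-- The same with the hypothesis on the rational prime `p = primesEquiv v` (as the fact reads the
places of `ℚ`): `p ∤ |d_K| ⇒ e_p = 1`. [cite: NeukirchANT1999, Ch. III §2, Cor. (2.12)] -/
theorem ramificationIdxIn_eq_one_of_not_dvd_natAbs_discr (v : HeightOneSpectrum (𝓞 ℚ))
    (hnd : ¬ ((Rat.HeightOneSpectrum.primesEquiv v : Nat.Primes) : ℕ) ∣ (NumberField.discr K).natAbs) :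
    v.asIdeal.ramificationIdxIn (𝓞 K) = 1 := by
  refine ramificationIdxIn_eq_one_of_not_dvd_discr K v fun h => hnd ?_
  have h' : (Rat.HeightOneSpectrum.natGenerator v : ℤ).natAbs ∣ (NumberField.discr K).natAbs :=
    Int.natAbs_dvd_natAbs.mpr h
  rw [Int.natAbs_natCast] at h'
  exact h'

/-- In particular `p ∤ N` and `|d_K| ∣ N` give `e_p = 1` — the clause "`p` is unramified in `K`" of
`Ribet1977_cmNewform_of_heckeCharacter` for a level `N = |d_K| · M` (Ribet 1977, §3: level `DM`,
`-D` the discriminant of `F`). [cite: Ribet1977Nebentypus, §3, Thm. (3.4) (LNM 601, p. 35)] -/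
theorem ramificationIdxIn_eq_one_of_not_dvd_level (v : HeightOneSpectrum (𝓞 ℚ)) {N : ℕ}
    (hD : (NumberField.discr K).natAbs ∣ N)
    (hv : ¬ ((Rat.HeightOneSpectrum.primesEquiv v : Nat.Primes) : ℕ) ∣ N) :
    v.asIdeal.ramificationIdxIn (𝓞 K) = 1 :=
  ramificationIdxIn_eq_one_of_not_dvd_natAbs_discr K v fun h => hv (h.trans hD)

end Discriminant

/-! ### Places of a quadratic extension above an unramified place -/

section QuadraticPlaces

variable {F E : Type} [Field F] [NumberField F] [Field E] [NumberField E] [Algebra F E]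

omit [NumberField F] [NumberField E] in
/-- The set of places `w` of `E` above the place `v` of `F`, written with `Ideal.under` as in
`inducedFrobPolynomial`, has `Nat.card` equal to the number of places above `v` counted on the
subtype `{w // w.under (𝓞 F) = v}` of `Literature.NumberTheory.Automorphic.card_placesOver`. [folklore] -/
theorem ncard_setOf_asIdeal_under_eq (v : HeightOneSpectrum (𝓞 F)) :
    {w : HeightOneSpectrum (𝓞 E) | w.asIdeal.under (𝓞 F) = v.asIdeal}.ncard =
      Nat.card {w : HeightOneSpectrum (𝓞 E) // w.under (𝓞 F) = v} := by
  rw [← Nat.card_coe_set_eq]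
  refine Nat.card_congr (Equiv.subtypeEquivRight fun w => ?_)
  rw [Set.mem_setOf_eq, HeightOneSpectrum.ext_iff, HeightOneSpectrum.under_asIdeal]

/-- **Split or inert.** In a quadratic extension `E/F` of number fields, above a finite place `v`
of `F` which is unramified in `E` (`e_v = 1`, Mathlib `Ideal.ramificationIdxIn`) there are either
exactly two places `w₁ ≠ w₂`, both of residue degree `1` (`v` splits), or exactly one place, of
residue degree `2` (`v` is inert): the fundamental identity `#{w ∣ v} · e_v · f_v = [E : F] = 2`
(Neukirch, Ch. I, (9.2); tree `card_placesOver_mul_inertiaDegIn`). [cite: NeukirchANT1999, Ch. I, Prop. (9.2)] -/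
theorem exists_places_eq_pair_or_eq_singleton (h2 : Module.finrank F E = 2)
    (v : HeightOneSpectrum (𝓞 F)) (hv : v.asIdeal.ramificationIdxIn (𝓞 E) = 1) :
    (∃ w₁ w₂ : HeightOneSpectrum (𝓞 E), w₁ ≠ w₂ ∧
        {w : HeightOneSpectrum (𝓞 E) | w.asIdeal.under (𝓞 F) = v.asIdeal} = {w₁, w₂} ∧
        w₁.asIdeal.inertiaDeg (𝓞 F) = 1 ∧ w₂.asIdeal.inertiaDeg (𝓞 F) = 1) ∨
      ∃ w : HeightOneSpectrum (𝓞 E),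
        {w : HeightOneSpectrum (𝓞 E) | w.asIdeal.under (𝓞 F) = v.asIdeal} = {w} ∧
        w.asIdeal.inertiaDeg (𝓞 F) = 2 := by
  haveI : Algebra.IsQuadraticExtension F E := { finrank_eq_two' := h2 }
  have hfund := Literature.NumberTheory.Automorphic.card_placesOver_mul_inertiaDegIn (E := E) v hv
  rw [h2, ← ncard_setOf_asIdeal_under_eq] at hfund
  set S : Set (HeightOneSpectrum (𝓞 E)) := {w | w.asIdeal.under (𝓞 F) = v.asIdeal} with hS
  -- every place above `v` has residue degree `f_v = inertiaDegIn`
  have hf : ∀ w ∈ S, w.asIdeal.inertiaDeg (𝓞 F) = v.asIdeal.inertiaDegIn (𝓞 E) := by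
    intro w hw
    have hw' : w.under (𝓞 F) = v :=
      HeightOneSpectrum.ext (by rw [HeightOneSpectrum.under_asIdeal]; exact hw)
    rw [Literature.NumberTheory.Automorphic.inertiaDeg_eq_inertiaDegIn_under, hw']
  -- `#S · f_v = 2` forces `(#S, f_v) ∈ {(2, 1), (1, 2)}`
  have hcases : S.ncard = 2 ∧ v.asIdeal.inertiaDegIn (𝓞 E) = 1 ∨
      S.ncard = 1 ∧ v.asIdeal.inertiaDegIn (𝓞 E) = 2 := by
    have hdvd : S.ncard ∣ 2 := Dvd.intro _ hfund
    have hle : S.ncard ≤ 2 := Nat.le_of_dvd two_pos hdvd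
    interval_cases h : S.ncard
    · simp at hfund
    · right; exact ⟨rfl, by simpa using hfund⟩
    · left; exact ⟨rfl, by simpa using hfund⟩
  rcases hcases with ⟨hcard, hf1⟩ | ⟨hcard, hf2⟩
  · obtain ⟨w₁, w₂, hne, hSeq⟩ := Set.ncard_eq_two.mp hcard
    refine Or.inl ⟨w₁, w₂, hne, hSeq, ?_, ?_⟩
    · rw [hf w₁ (by rw [hSeq]; exact Set.mem_insert _ _), hf1]
    · rw [hf w₂ (by rw [hSeq]; exact Set.mem_insert_of_mem _ rfl), hf1]
  · obtain ⟨w, hSeq⟩ := Set.ncard_eq_one.mp hcard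
    refine Or.inr ⟨w, hSeq, ?_⟩
    rw [hf w (by rw [hSeq]; exact Set.mem_singleton _), hf2]

end QuadraticPlaces

/-! ### The induced Frobenius polynomial of a family of linear polynomials at a split / inert place -/

section Induced

variable {F E : Type} [Field F] [Field E] [Algebra F E] {A : Type*} [CommRing A]

/-- **Split place**: if the places of `E` above `v` are `w₁ ≠ w₂`, both of residue degree `1`, then
`∏_{w ∣ v} (X^{f(w|v)} - c_w) = (X - c_{w₁})(X - c_{w₂})`. [folklore] -/
theorem inducedFrobPolynomial_linear_of_pair (v : HeightOneSpectrum (𝓞 F))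
    (c : HeightOneSpectrum (𝓞 E) → A) {w₁ w₂ : HeightOneSpectrum (𝓞 E)} (hne : w₁ ≠ w₂)
    (hS : {w : HeightOneSpectrum (𝓞 E) | w.asIdeal.under (𝓞 F) = v.asIdeal} = {w₁, w₂})
    (h₁ : w₁.asIdeal.inertiaDeg (𝓞 F) = 1) (h₂ : w₂.asIdeal.inertiaDeg (𝓞 F) = 1) :
    inducedFrobPolynomial v (fun w => X - C (c w)) = (X - C (c w₁)) * (X - C (c w₂)) := by
  rw [inducedFrobPolynomial_def, hS, finprod_mem_pair hne, h₁, h₂, pow_one, comp_X, comp_X]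

/-- **Inert place**: if `w` is the only place of `E` above `v` and has residue degree `2`, then
`∏_{w ∣ v} (X^{f(w|v)} - c_w) = X² - c_w`. [folklore] -/
theorem inducedFrobPolynomial_linear_of_singleton (v : HeightOneSpectrum (𝓞 F))
    (c : HeightOneSpectrum (𝓞 E) → A) {w : HeightOneSpectrum (𝓞 E)}
    (hS : {w : HeightOneSpectrum (𝓞 E) | w.asIdeal.under (𝓞 F) = v.asIdeal} = {w})
    (hw : w.asIdeal.inertiaDeg (𝓞 F) = 2) :
    inducedFrobPolynomial v (fun w => X - C (c w)) = X ^ 2 - C (c w) := by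
  rw [inducedFrobPolynomial_def, hS, finprod_mem_singleton, hw, sub_comp, X_comp, C_comp]

end Induced

/-! ### Reading the Hecke polynomial `X² - a_p X + ε(p) p^{k-1}` against a product of linear factors -/

section HeckePolynomial

variable {N : ℕ} [NeZero N] {k : ℤ}

/-- Two monic quadratics `X² - a X + b` agree iff their coefficients do. [folklore] -/
theorem X_sq_sub_C_mul_X_add_C_inj {R : Type*} [CommRing R] [Nontrivial R] {a b a' b' : R} :
    (X ^ 2 - C a * X + C b : R[X]) = X ^ 2 - C a' * X + C b' ↔ a = a' ∧ b = b' := by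
  constructor
  · intro h
    have h1 := congrArg (fun P : R[X] => P.coeff 1) h
    have h0 := congrArg (fun P : R[X] => P.coeff 0) h
    simp only [coeff_add, coeff_sub, coeff_X_pow, coeff_C_mul, coeff_X_one,
      coeff_X_zero, coeff_C, mul_one, mul_zero] at h1 h0
    norm_num at h1 h0
    exact ⟨h1, h0⟩
  · rintro ⟨rfl, rfl⟩
    rfl

/-- `(X - α)(X - β) = X² - (α + β) X + αβ`. [folklore] -/
theorem X_sub_C_mul_X_sub_C {R : Type*} [CommRing R] (α β : R) :
    ((X - C α) * (X - C β) : R[X]) = X ^ 2 - C (α + β) * X + C (α * β) := by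
  simp only [map_add, map_mul]
  ring

/-- **Split shape.** For `f ∈ S_k(Γ₁(N))` and `α, β ∈ ℂ`:
`X² - a_q(f) X + ε(q) q^{k-1} = (X - α)(X - β)` iff `a_q(f) = α + β` and `ε(q) q^{k-1} = αβ`
(`ε = nebentypus f`). [folklore] -/
theorem map_heckePolynomial_eq_mul_linear_iff (f : CuspForm (Gamma1 N) k) (q : ℕ) (α β : ℂ) :
    (heckePolynomial f q).map (algebraMap (coeffCharField f) ℂ) = (X - C α) * (X - C β) ↔
      (qExpansion 1 ⇑f).coeff q = α + β ∧
        (nebentypus f (q : ZMod N) : ℂ) * (q : ℂ) ^ (k - 1) = α * β := by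
  rw [map_heckePolynomial, X_sub_C_mul_X_sub_C, X_sq_sub_C_mul_X_add_C_inj]

/-- **Inert shape.** For `f ∈ S_k(Γ₁(N))` and `γ ∈ ℂ`:
`X² - a_q(f) X + ε(q) q^{k-1} = X² - γ` iff `a_q(f) = 0` and `ε(q) q^{k-1} = -γ`. [folklore] -/
theorem map_heckePolynomial_eq_X_sq_sub_iff (f : CuspForm (Gamma1 N) k) (q : ℕ) (γ : ℂ) :
    (heckePolynomial f q).map (algebraMap (coeffCharField f) ℂ) = X ^ 2 - C γ ↔
      (qExpansion 1 ⇑f).coeff q = 0 ∧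
        (nebentypus f (q : ZMod N) : ℂ) * (q : ℂ) ^ (k - 1) = -γ := by
  have h : (X ^ 2 - C γ : ℂ[X]) = X ^ 2 - C 0 * X + C (-γ) := by
    simp only [map_zero, zero_mul, sub_zero, map_neg]
    ring
  rw [map_heckePolynomial, h, X_sq_sub_C_mul_X_add_C_inj]

end HeckePolynomial

/-! ### The Euler-factor clause of the fact, prime by prime -/

section EulerFactor

variable {K : Type} [Field K] [NumberField K] {N : ℕ} [NeZero N] {k : ℤ}

/-- **At a split prime** `p = 𝔭𝔭̄` of the quadratic field `K` (places `w₁ ≠ w₂` above `p`, both of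
degree `1`), the Euler-factor clause of `Ribet1977_cmNewform_of_heckeCharacter` for
`f ∈ S_k(Γ₁(N))` and the Hecke character `ψ` reads `a_p(f) = ψ(ϖ_𝔭) + ψ(ϖ_𝔭̄)` and
`ε(p) p^{k-1} = ψ(ϖ_𝔭) ψ(ϖ_𝔭̄)` — Ribet's `a_p = ∑_{N𝔞 = p} ψ(𝔞)`, `ε(p) p^{k-1} = η(p) p^{k-1} = ψ((p))`.
[cite: Ribet1977Nebentypus, §3, Cor. (3.5) (LNM 601, p. 35)] -/
theorem map_heckePolynomial_eq_inducedFrobPolynomial_iff_of_pair (f : CuspForm (Gamma1 N) k)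
    (ψ : HeckeCharacter K) (v : HeightOneSpectrum (𝓞 ℚ)) {w₁ w₂ : HeightOneSpectrum (𝓞 K)}
    (hne : w₁ ≠ w₂)
    (hS : {w : HeightOneSpectrum (𝓞 K) | w.asIdeal.under (𝓞 ℚ) = v.asIdeal} = {w₁, w₂})
    (h₁ : w₁.asIdeal.inertiaDeg (𝓞 ℚ) = 1) (h₂ : w₂.asIdeal.inertiaDeg (𝓞 ℚ) = 1) (q : ℕ) :
    (heckePolynomial f q).map (algebraMap (coeffCharField f) ℂ) =
        inducedFrobPolynomial v (fun w => X - C (ψ.valueAtUniformizer w)) ↔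
      (qExpansion 1 ⇑f).coeff q = ψ.valueAtUniformizer w₁ + ψ.valueAtUniformizer w₂ ∧
        (nebentypus f (q : ZMod N) : ℂ) * (q : ℂ) ^ (k - 1) =
          ψ.valueAtUniformizer w₁ * ψ.valueAtUniformizer w₂ := by
  rw [inducedFrobPolynomial_linear_of_pair v _ hne hS h₁ h₂, map_heckePolynomial_eq_mul_linear_iff]

/-- **At an inert prime** `p` of the quadratic field `K` (one place `w` above `p`, of degree `2`),
the Euler-factor clause of `Ribet1977_cmNewform_of_heckeCharacter` reads `a_p(f) = 0` and
`ε(p) p^{k-1} = -ψ(ϖ_w)` — Ribet's "`a_p = 0` if `φ(p) = -1`" together with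
`ε(p) p^{k-1} = φ(p) η(p) p^{k-1} = -ψ((p))`. [cite: Ribet1977Nebentypus, §3, Cor. (3.5) (LNM 601, p. 35)] -/
theorem map_heckePolynomial_eq_inducedFrobPolynomial_iff_of_singleton (f : CuspForm (Gamma1 N) k)
    (ψ : HeckeCharacter K) (v : HeightOneSpectrum (𝓞 ℚ)) {w : HeightOneSpectrum (𝓞 K)}
    (hS : {w : HeightOneSpectrum (𝓞 K) | w.asIdeal.under (𝓞 ℚ) = v.asIdeal} = {w})
    (hw : w.asIdeal.inertiaDeg (𝓞 ℚ) = 2) (q : ℕ) :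
    (heckePolynomial f q).map (algebraMap (coeffCharField f) ℂ) =
        inducedFrobPolynomial v (fun w => X - C (ψ.valueAtUniformizer w)) ↔
      (qExpansion 1 ⇑f).coeff q = 0 ∧
        (nebentypus f (q : ZMod N) : ℂ) * (q : ℂ) ^ (k - 1) = -ψ.valueAtUniformizer w := by
  rw [inducedFrobPolynomial_linear_of_singleton v _ hS hw, map_heckePolynomial_eq_X_sq_sub_iff]

end EulerFactor

/-! ### Ideals of prime norm: Ribet's `a_p = ∑_{N𝔞 = p} ψ(𝔞)` and `η(p) p^{k-1} = ψ((p))` -/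

section PrimeNorm

variable {K : Type} [Field K] [NumberField K]

/-- `N(𝔭_w) = p_w^{f_w}`: the absolute norm of the prime `𝔭_w` of `𝓞 K` is the rational prime
`p_w` below it (`Rat.HeightOneSpectrum.natGenerator` of the place `w ∩ 𝓞 ℚ`) to the residue degree
`f(w|p_w)` (tree `residueCard_eq_pow_inertiaDeg`, `Rat.residueCard_eq_natGenerator`; Neukirch,
Ch. I, (8.2)). [cite: NeukirchANT1999, Ch. I, Prop. (8.2)] -/
theorem absNorm_asIdeal_eq_natGenerator_pow (w : HeightOneSpectrum (𝓞 K)) :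
    Ideal.absNorm w.asIdeal =
      Rat.HeightOneSpectrum.natGenerator (w.under (𝓞 ℚ)) ^ w.asIdeal.inertiaDeg (𝓞 ℚ) := by
  have h := Literature.NumberTheory.Automorphic.residueCard_eq_pow_inertiaDeg (F := ℚ) w
  rwa [Rat.residueCard_eq_natGenerator] at h

/-- A place `w` of `K` lies above the place `v` of `ℚ` iff the rational prime `p_v` lies in `𝔭_w`.
[folklore] -/
theorem asIdeal_under_eq_iff_natCast_mem (v : HeightOneSpectrum (𝓞 ℚ)) (w : HeightOneSpectrum (𝓞 K)) :
    w.asIdeal.under (𝓞 ℚ) = v.asIdeal ↔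
      ((Rat.HeightOneSpectrum.natGenerator v : ℕ) : 𝓞 K) ∈ w.asIdeal := by
  constructor
  · intro h
    have h1 : ((Rat.HeightOneSpectrum.natGenerator v : ℕ) : 𝓞 ℚ) ∈ v.asIdeal :=
      (Rat.natCast_mem_asIdeal_iff v).mpr dvd_rfl
    rw [← h, Ideal.under_def, Ideal.mem_comap, map_natCast] at h1
    exact h1
  · intro hmem
    have h1 : ((Rat.HeightOneSpectrum.natGenerator v : ℕ) : 𝓞 ℚ) ∈ (w.under (𝓞 ℚ)).asIdeal := by
      rw [HeightOneSpectrum.under_asIdeal, Ideal.under_def, Ideal.mem_comap, map_natCast]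
      exact hmem
    rw [Rat.natCast_mem_asIdeal_iff] at h1
    have heq : Rat.HeightOneSpectrum.natGenerator (w.under (𝓞 ℚ)) =
        Rat.HeightOneSpectrum.natGenerator v :=
      (Nat.prime_dvd_prime_iff_eq (Rat.HeightOneSpectrum.prime_natGenerator _)
        (Rat.HeightOneSpectrum.prime_natGenerator v)).mp h1
    have hwv : w.under (𝓞 ℚ) = v :=
      (Rat.HeightOneSpectrum.primesEquiv (R := 𝓞 ℚ)).injective (Subtype.ext heq)
    rw [← hwv, HeightOneSpectrum.under_asIdeal]

/-- **The ideals of prime norm `p` are the primes above `p` of residue degree one.**  For the place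
`v` of `ℚ` under the rational prime `p = p_v` and an ideal `𝔞` of `𝓞 K`: `N𝔞 = p` iff
`𝔞 = 𝔭_w` for a place `w ∣ v` with `f(w|v) = 1` (an ideal of prime norm is prime, Mathlib
`Ideal.isPrime_of_irreducible_absNorm`, contains its norm, `Ideal.absNorm_mem`, and
`N(𝔭_w) = p^{f_w}`).  This is the dictionary between Ribet's "`a_p = ∑_{N𝔞 = p} ψ(𝔞)`", "no
ideal of `F` has norm `p`" (LNM 601, p. 35) and the places of `K` above `p`. [cite: NeukirchANT1999, Ch. I, Prop. (8.2)] -/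
theorem absNorm_eq_natGenerator_iff (v : HeightOneSpectrum (𝓞 ℚ)) (I : Ideal (𝓞 K)) :
    Ideal.absNorm I = Rat.HeightOneSpectrum.natGenerator v ↔
      ∃ w : HeightOneSpectrum (𝓞 K), w.asIdeal = I ∧ w.asIdeal.under (𝓞 ℚ) = v.asIdeal ∧
        w.asIdeal.inertiaDeg (𝓞 ℚ) = 1 := by
  have hpp : (Rat.HeightOneSpectrum.natGenerator v).Prime := Rat.HeightOneSpectrum.prime_natGenerator v
  constructor
  · intro hI
    have hI0 : I ≠ ⊥ := by
      rintro rfl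
      rw [Ideal.absNorm_bot] at hI
      exact hpp.ne_zero hI.symm
    have hprime : I.IsPrime := Ideal.isPrime_of_irreducible_absNorm (by rw [hI]; exact hpp)
    set w : HeightOneSpectrum (𝓞 K) := ⟨I, hprime, hI0⟩ with hw
    have hmem : ((Rat.HeightOneSpectrum.natGenerator v : ℕ) : 𝓞 K) ∈ w.asIdeal := by
      have := Ideal.absNorm_mem I
      rw [hI] at this
      exact_mod_cast this
    have hunder : w.asIdeal.under (𝓞 ℚ) = v.asIdeal := (asIdeal_under_eq_iff_natCast_mem v w).mpr hmem
    have hwv : w.under (𝓞 ℚ) = v :=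
      HeightOneSpectrum.ext (by rw [HeightOneSpectrum.under_asIdeal]; exact hunder)
    refine ⟨w, rfl, hunder, ?_⟩
    have h := absNorm_asIdeal_eq_natGenerator_pow w
    rw [hwv] at h
    have h1 : Rat.HeightOneSpectrum.natGenerator v ^ w.asIdeal.inertiaDeg (𝓞 ℚ) =
        Rat.HeightOneSpectrum.natGenerator v ^ 1 := by
      rw [pow_one, ← h]; exact hI
    exact Nat.pow_right_injective hpp.two_le h1
  · rintro ⟨w, rfl, hunder, hf⟩
    have hwv : w.under (𝓞 ℚ) = v :=
      HeightOneSpectrum.ext (by rw [HeightOneSpectrum.under_asIdeal]; exact hunder)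
    rw [absNorm_asIdeal_eq_natGenerator_pow, hwv, hf, pow_one]

/-- **Split `p`: the ideals of norm `p` are `𝔭` and `𝔭̄`.**  If the places of `K` above `v` are
`w₁ ≠ w₂`, both of residue degree `1`, then `{𝔞 : N𝔞 = p_v} = {𝔭_{w₁}, 𝔭_{w₂}}`. [cite: NeukirchANT1999, Ch. I, Prop. (8.2)] -/
theorem setOf_absNorm_eq_of_pair (v : HeightOneSpectrum (𝓞 ℚ)) {w₁ w₂ : HeightOneSpectrum (𝓞 K)}
    (hS : {w : HeightOneSpectrum (𝓞 K) | w.asIdeal.under (𝓞 ℚ) = v.asIdeal} = {w₁, w₂})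
    (h₁ : w₁.asIdeal.inertiaDeg (𝓞 ℚ) = 1) (h₂ : w₂.asIdeal.inertiaDeg (𝓞 ℚ) = 1) :
    {I : Ideal (𝓞 K) | Ideal.absNorm I = Rat.HeightOneSpectrum.natGenerator v} =
      {w₁.asIdeal, w₂.asIdeal} := by
  ext I
  simp only [Set.mem_setOf_eq, Set.mem_insert_iff, Set.mem_singleton_iff]
  rw [absNorm_eq_natGenerator_iff]
  constructor
  · rintro ⟨w, rfl, hunder, -⟩
    have hw : w ∈ ({w₁, w₂} : Set (HeightOneSpectrum (𝓞 K))) := by rw [← hS]; exact hunder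
    rcases hw with rfl | rfl
    · exact Or.inl rfl
    · exact Or.inr rfl
  · have hm₁ : w₁ ∈ {w : HeightOneSpectrum (𝓞 K) | w.asIdeal.under (𝓞 ℚ) = v.asIdeal} := by
      rw [hS]; exact Set.mem_insert _ _
    have hm₂ : w₂ ∈ {w : HeightOneSpectrum (𝓞 K) | w.asIdeal.under (𝓞 ℚ) = v.asIdeal} := by
      rw [hS]; exact Set.mem_insert_of_mem _ rfl
    rintro (rfl | rfl)
    · exact ⟨w₁, rfl, hm₁, h₁⟩
    · exact ⟨w₂, rfl, hm₂, h₂⟩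

/-- **Inert `p`: no ideal has norm `p`** (Ribet, LNM 601, p. 35: "`c_p = 0` if no ideal of `F` has
norm `p`").  If the only place of `K` above `v` has residue degree `2`, then
`{𝔞 : N𝔞 = p_v} = ∅`. [cite: Ribet1977Nebentypus, §3, proof of Cor. (3.5) (LNM 601, p. 35)] -/
theorem setOf_absNorm_eq_of_singleton (v : HeightOneSpectrum (𝓞 ℚ)) {w : HeightOneSpectrum (𝓞 K)}
    (hS : {w : HeightOneSpectrum (𝓞 K) | w.asIdeal.under (𝓞 ℚ) = v.asIdeal} = {w})
    (hw : w.asIdeal.inertiaDeg (𝓞 ℚ) = 2) :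
    {I : Ideal (𝓞 K) | Ideal.absNorm I = Rat.HeightOneSpectrum.natGenerator v} = ∅ := by
  ext I
  simp only [Set.mem_setOf_eq, Set.mem_empty_iff_false, iff_false]
  rw [absNorm_eq_natGenerator_iff]
  rintro ⟨w', rfl, hunder, hf⟩
  have hw' : w' ∈ ({w} : Set (HeightOneSpectrum (𝓞 K))) := by rw [← hS]; exact hunder
  rw [Set.mem_singleton_iff] at hw'
  rw [hw', hw] at hf
  exact absurd hf (by norm_num)

/-- **`a_p = ψ(𝔭) + ψ(𝔭̄)` at a split prime**: for any function `g` on ideals,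
`∑_{N𝔞 = p} g(𝔞) = g(𝔭_{w₁}) + g(𝔭_{w₂})` (Ribet 1977, Cor. (3.5): `a_p = ∑_{N𝔞 = p} ψ(𝔞)`).
[cite: Ribet1977Nebentypus, §3, Thm. (3.4)–Cor. (3.5) (LNM 601, p. 35)] -/
theorem finsum_mem_setOf_absNorm_eq_of_pair {M : Type*} [AddCommMonoid M] (v : HeightOneSpectrum (𝓞 ℚ))
    {w₁ w₂ : HeightOneSpectrum (𝓞 K)} (hne : w₁ ≠ w₂)
    (hS : {w : HeightOneSpectrum (𝓞 K) | w.asIdeal.under (𝓞 ℚ) = v.asIdeal} = {w₁, w₂})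
    (h₁ : w₁.asIdeal.inertiaDeg (𝓞 ℚ) = 1) (h₂ : w₂.asIdeal.inertiaDeg (𝓞 ℚ) = 1)
    (g : Ideal (𝓞 K) → M) :
    ∑ᶠ I ∈ {I : Ideal (𝓞 K) | Ideal.absNorm I = Rat.HeightOneSpectrum.natGenerator v}, g I =
      g w₁.asIdeal + g w₂.asIdeal := by
  rw [setOf_absNorm_eq_of_pair v hS h₁ h₂,
    finsum_mem_pair (fun h => hne (HeightOneSpectrum.ext h))]

/-- **`a_p = 0` at an inert prime**: `∑_{N𝔞 = p} g(𝔞) = 0` (empty sum; Ribet 1977, Cor. (3.5):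
"`a_p = 0` if `φ(p) = -1`"). [cite: Ribet1977Nebentypus, §3, Cor. (3.5) (LNM 601, p. 35)] -/
theorem finsum_mem_setOf_absNorm_eq_of_singleton {M : Type*} [AddCommMonoid M]
    (v : HeightOneSpectrum (𝓞 ℚ)) {w : HeightOneSpectrum (𝓞 K)}
    (hS : {w : HeightOneSpectrum (𝓞 K) | w.asIdeal.under (𝓞 ℚ) = v.asIdeal} = {w})
    (hw : w.asIdeal.inertiaDeg (𝓞 ℚ) = 2) (g : Ideal (𝓞 K) → M) :
    ∑ᶠ I ∈ {I : Ideal (𝓞 K) | Ideal.absNorm I = Rat.HeightOneSpectrum.natGenerator v}, g I = 0 := by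
  rw [setOf_absNorm_eq_of_singleton v hS hw, finsum_mem_empty]

/-! ### The ideal `(p) = p 𝓞_K` at an unramified prime and the value `ψ((p))` -/

omit [NumberField K] in
/-- Two ideals of a ring of integers with `J ∣ I` and the same nonzero absolute norm are equal.
[folklore] -/
theorem eq_of_dvd_of_absNorm_eq [NumberField K] {I J : Ideal (𝓞 K)} (hJI : J ∣ I)
    (hn : Ideal.absNorm I = Ideal.absNorm J) (hI : Ideal.absNorm I ≠ 0) : I = J := by
  obtain ⟨M, rfl⟩ := hJI
  rw [map_mul] at hn hI
  have hJ0 : Ideal.absNorm J ≠ 0 := left_ne_zero_of_mul hI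
  have hM : Ideal.absNorm M = 1 :=
    mul_left_cancel₀ hJ0 (by rw [mul_one]; exact hn)
  rw [Ideal.absNorm_eq_one_iff.mp hM, Ideal.mul_top]

/-- For a place `w ∣ v`, the rational prime `p_v` lies in `𝔭_w`, i.e. `𝔭_w ∣ (p_v)`. [folklore] -/
theorem asIdeal_dvd_span_natGenerator (v : HeightOneSpectrum (𝓞 ℚ)) {w : HeightOneSpectrum (𝓞 K)}
    (hw : w.asIdeal.under (𝓞 ℚ) = v.asIdeal) :
    w.asIdeal ∣ Ideal.span {((Rat.HeightOneSpectrum.natGenerator v : ℕ) : 𝓞 K)} := by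
  rw [Ideal.dvd_span_singleton]
  exact (asIdeal_under_eq_iff_natCast_mem v w).mp hw

/-- **Split `p`: `(p) = 𝔭 𝔭̄`.**  If the places of the quadratic field `K` above `v` are `w₁ ≠ w₂`,
both of residue degree `1`, then `p_v 𝓞_K = 𝔭_{w₁} 𝔭_{w₂}` (both divide `(p)`, they are coprime,
and the norms agree: `p · p = p²`). [cite: NeukirchANT1999, Ch. I, Prop. (8.2)] -/
theorem span_natGenerator_eq_mul_of_pair (h2 : Module.finrank ℚ K = 2) (v : HeightOneSpectrum (𝓞 ℚ))
    {w₁ w₂ : HeightOneSpectrum (𝓞 K)} (hne : w₁ ≠ w₂)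
    (hS : {w : HeightOneSpectrum (𝓞 K) | w.asIdeal.under (𝓞 ℚ) = v.asIdeal} = {w₁, w₂})
    (h₁ : w₁.asIdeal.inertiaDeg (𝓞 ℚ) = 1) (h₂ : w₂.asIdeal.inertiaDeg (𝓞 ℚ) = 1) :
    Ideal.span {((Rat.HeightOneSpectrum.natGenerator v : ℕ) : 𝓞 K)} = w₁.asIdeal * w₂.asIdeal := by
  set p := Rat.HeightOneSpectrum.natGenerator v with hp
  have hpp : p.Prime := Rat.HeightOneSpectrum.prime_natGenerator v
  have hm₁ : w₁.asIdeal.under (𝓞 ℚ) = v.asIdeal := by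
    have : w₁ ∈ {w : HeightOneSpectrum (𝓞 K) | w.asIdeal.under (𝓞 ℚ) = v.asIdeal} := by
      rw [hS]; exact Set.mem_insert _ _
    exact this
  have hm₂ : w₂.asIdeal.under (𝓞 ℚ) = v.asIdeal := by
    have : w₂ ∈ {w : HeightOneSpectrum (𝓞 K) | w.asIdeal.under (𝓞 ℚ) = v.asIdeal} := by
      rw [hS]; exact Set.mem_insert_of_mem _ rfl
    exact this
  -- `𝔭₁ 𝔭₂ ∣ (p)`
  have hne' : w₁.asIdeal ≠ w₂.asIdeal := fun h => hne (HeightOneSpectrum.ext h)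
  have hcop : IsCoprime w₁.asIdeal w₂.asIdeal :=
    (Ideal.isCoprime_iff_sup_eq.mpr (w₁.isMaximal.coprime_of_ne w₂.isMaximal hne'))
  have hdvd : w₁.asIdeal * w₂.asIdeal ∣ Ideal.span {(p : 𝓞 K)} :=
    hcop.mul_dvd (asIdeal_dvd_span_natGenerator v hm₁) (asIdeal_dvd_span_natGenerator v hm₂)
  -- norms: `N(𝔭₁ 𝔭₂) = p² = N((p))`
  have hn₁ : Ideal.absNorm w₁.asIdeal = p :=
    (absNorm_eq_natGenerator_iff v _).mpr ⟨w₁, rfl, hm₁, h₁⟩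
  have hn₂ : Ideal.absNorm w₂.asIdeal = p :=
    (absNorm_eq_natGenerator_iff v _).mpr ⟨w₂, rfl, hm₂, h₂⟩
  refine eq_of_dvd_of_absNorm_eq hdvd ?_ ?_
  · rw [Literature.NumberTheory.LFunctions.IdealNormCount.absNorm_span_natCast K, h2, map_mul, hn₁, hn₂, sq]
  · rw [Literature.NumberTheory.LFunctions.IdealNormCount.absNorm_span_natCast K, h2]
    exact pow_ne_zero 2 hpp.ne_zero

/-- **Inert `p`: `(p) = 𝔭` is prime.**  If the only place `w` of the quadratic field `K` above `v`
has residue degree `2`, then `p_v 𝓞_K = 𝔭_w`. [cite: NeukirchANT1999, Ch. I, Prop. (8.2)] -/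
theorem span_natGenerator_eq_of_singleton (h2 : Module.finrank ℚ K = 2) (v : HeightOneSpectrum (𝓞 ℚ))
    {w : HeightOneSpectrum (𝓞 K)}
    (hS : {w : HeightOneSpectrum (𝓞 K) | w.asIdeal.under (𝓞 ℚ) = v.asIdeal} = {w})
    (hw : w.asIdeal.inertiaDeg (𝓞 ℚ) = 2) :
    Ideal.span {((Rat.HeightOneSpectrum.natGenerator v : ℕ) : 𝓞 K)} = w.asIdeal := by
  set p := Rat.HeightOneSpectrum.natGenerator v with hp
  have hpp : p.Prime := Rat.HeightOneSpectrum.prime_natGenerator v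
  have hm : w.asIdeal.under (𝓞 ℚ) = v.asIdeal := by
    have : w ∈ {w : HeightOneSpectrum (𝓞 K) | w.asIdeal.under (𝓞 ℚ) = v.asIdeal} := by
      rw [hS]; exact Set.mem_singleton _
    exact this
  have hwv : w.under (𝓞 ℚ) = v :=
    HeightOneSpectrum.ext (by rw [HeightOneSpectrum.under_asIdeal]; exact hm)
  have hn : Ideal.absNorm w.asIdeal = p ^ 2 := by
    rw [absNorm_asIdeal_eq_natGenerator_pow, hwv, hw]
  refine eq_of_dvd_of_absNorm_eq (asIdeal_dvd_span_natGenerator v hm) ?_ ?_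
  · rw [Literature.NumberTheory.LFunctions.IdealNormCount.absNorm_span_natCast K, h2, hn]
  · rw [Literature.NumberTheory.LFunctions.IdealNormCount.absNorm_span_natCast K, h2]
    exact pow_ne_zero 2 hpp.ne_zero

/-- **`ψ((p)) = ψ(𝔭) ψ(𝔭̄)` at a split prime** for the ideal character `𝔞 ↦ ∏_𝔭 ψ(𝔭)^{v_𝔭(𝔞)}`
(`Literature.NumberTheory.LFunctions.idealPow`) — Ribet's `η(p) p^{k-1} = ψ((p))` read on the two
places above `p`. [cite: Ribet1977Nebentypus, §3 (LNM 601, p. 34)] -/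
theorem idealPow_span_natGenerator_of_pair (h2 : Module.finrank ℚ K = 2) (c : HeightOneSpectrum (𝓞 K) → ℂ)
    (v : HeightOneSpectrum (𝓞 ℚ)) {w₁ w₂ : HeightOneSpectrum (𝓞 K)} (hne : w₁ ≠ w₂)
    (hS : {w : HeightOneSpectrum (𝓞 K) | w.asIdeal.under (𝓞 ℚ) = v.asIdeal} = {w₁, w₂})
    (h₁ : w₁.asIdeal.inertiaDeg (𝓞 ℚ) = 1) (h₂ : w₂.asIdeal.inertiaDeg (𝓞 ℚ) = 1) :
    Literature.NumberTheory.LFunctions.idealPow K c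
        (Ideal.span {((Rat.HeightOneSpectrum.natGenerator v : ℕ) : 𝓞 K)}) = c w₁ * c w₂ := by
  rw [span_natGenerator_eq_mul_of_pair h2 v hne hS h₁ h₂,
    Literature.NumberTheory.LFunctions.idealPow_mul c w₁.ne_bot w₂.ne_bot,
    Literature.NumberTheory.LFunctions.idealPow_asIdeal, Literature.NumberTheory.LFunctions.idealPow_asIdeal]

/-- **`ψ((p)) = ψ(𝔭_w)` at an inert prime** (`(p) = 𝔭_w`). [cite: Ribet1977Nebentypus, §3 (LNM 601, p. 34)] -/
theorem idealPow_span_natGenerator_of_singleton (h2 : Module.finrank ℚ K = 2)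
    (c : HeightOneSpectrum (𝓞 K) → ℂ) (v : HeightOneSpectrum (𝓞 ℚ)) {w : HeightOneSpectrum (𝓞 K)}
    (hS : {w : HeightOneSpectrum (𝓞 K) | w.asIdeal.under (𝓞 ℚ) = v.asIdeal} = {w})
    (hw : w.asIdeal.inertiaDeg (𝓞 ℚ) = 2) :
    Literature.NumberTheory.LFunctions.idealPow K c
        (Ideal.span {((Rat.HeightOneSpectrum.natGenerator v : ℕ) : 𝓞 K)}) = c w := by
  rw [span_natGenerator_eq_of_singleton h2 v hS hw, Literature.NumberTheory.LFunctions.idealPow_asIdeal]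

end PrimeNorm

/-! ### The Euler-factor clause in Ribet's printed form -/

section RibetForm

variable {K : Type} [Field K] [NumberField K] {N : ℕ} [NeZero N] {k : ℤ}

/-- **Ribet's form of the Euler-factor clause at a split prime.**  For the quadratic field `K`,
`f ∈ S_k(Γ₁(N))`, the Hecke character `ψ` with ideal character `ψ̃(𝔞) = ∏ ψ(ϖ_𝔭)^{v_𝔭(𝔞)}`, and a
place `v` of `ℚ` (prime `p = p_v`) which splits in `K`: the clause
`X² - a_p X + ε(p)p^{k-1} = ∏_{w ∣ p}(X^{f_w} - ψ(ϖ_w))` of `Ribet1977_cmNewform_of_heckeCharacter`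
holds iff `a_p(f) = ∑_{N𝔞 = p} ψ̃(𝔞)` and `ε(p) p^{k-1} = ψ̃((p))` — Cor. (3.5) "`a_p(f) = a_p`"
with `a_p = ∑_{N𝔞 = p} ψ(𝔞)`, and `ε(p) = η(p)φ(p)`, `η(p) p^{k-1} = ψ((p))`, `φ(p) = 1`.
[cite: Ribet1977Nebentypus, §3, Thm. (3.4), Cor. (3.5) (LNM 601, pp. 34–35)] -/
theorem map_heckePolynomial_eq_inducedFrobPolynomial_iff_ribet_of_pair (h2 : Module.finrank ℚ K = 2)
    (f : CuspForm (Gamma1 N) k) (ψ : HeckeCharacter K) (v : HeightOneSpectrum (𝓞 ℚ))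
    {w₁ w₂ : HeightOneSpectrum (𝓞 K)} (hne : w₁ ≠ w₂)
    (hS : {w : HeightOneSpectrum (𝓞 K) | w.asIdeal.under (𝓞 ℚ) = v.asIdeal} = {w₁, w₂})
    (h₁ : w₁.asIdeal.inertiaDeg (𝓞 ℚ) = 1) (h₂ : w₂.asIdeal.inertiaDeg (𝓞 ℚ) = 1) :
    (heckePolynomial f (Rat.HeightOneSpectrum.natGenerator v)).map (algebraMap (coeffCharField f) ℂ) =
        inducedFrobPolynomial v (fun w => X - C (ψ.valueAtUniformizer w)) ↔
      (qExpansion 1 ⇑f).coeff (Rat.HeightOneSpectrum.natGenerator v) =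
          ∑ᶠ I ∈ {I : Ideal (𝓞 K) | Ideal.absNorm I = Rat.HeightOneSpectrum.natGenerator v},
            Literature.NumberTheory.LFunctions.idealPow K (fun w => ψ.valueAtUniformizer w) I ∧
        (nebentypus f (Rat.HeightOneSpectrum.natGenerator v : ZMod N) : ℂ) *
            (Rat.HeightOneSpectrum.natGenerator v : ℂ) ^ (k - 1) =
          Literature.NumberTheory.LFunctions.idealPow K (fun w => ψ.valueAtUniformizer w)
            (Ideal.span {((Rat.HeightOneSpectrum.natGenerator v : ℕ) : 𝓞 K)}) := by
  rw [map_heckePolynomial_eq_inducedFrobPolynomial_iff_of_pair f ψ v hne hS h₁ h₂,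
    finsum_mem_setOf_absNorm_eq_of_pair v hne hS h₁ h₂,
    Literature.NumberTheory.LFunctions.idealPow_asIdeal, Literature.NumberTheory.LFunctions.idealPow_asIdeal,
    idealPow_span_natGenerator_of_pair h2 _ v hne hS h₁ h₂]

/-- **Ribet's form of the Euler-factor clause at an inert prime.**  Same setting, `v` inert in `K`:
the clause holds iff `a_p(f) = ∑_{N𝔞 = p} ψ̃(𝔞)` (an empty sum, "`a_p = 0` if `φ(p) = -1`") and
`ε(p) p^{k-1} = -ψ̃((p))` (`ε(p) = η(p)φ(p)`, `φ(p) = -1`).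
[cite: Ribet1977Nebentypus, §3, Thm. (3.4), Cor. (3.5) (LNM 601, pp. 34–35)] -/
theorem map_heckePolynomial_eq_inducedFrobPolynomial_iff_ribet_of_singleton (h2 : Module.finrank ℚ K = 2)
    (f : CuspForm (Gamma1 N) k) (ψ : HeckeCharacter K) (v : HeightOneSpectrum (𝓞 ℚ))
    {w : HeightOneSpectrum (𝓞 K)}
    (hS : {w : HeightOneSpectrum (𝓞 K) | w.asIdeal.under (𝓞 ℚ) = v.asIdeal} = {w})
    (hw : w.asIdeal.inertiaDeg (𝓞 ℚ) = 2) :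
    (heckePolynomial f (Rat.HeightOneSpectrum.natGenerator v)).map (algebraMap (coeffCharField f) ℂ) =
        inducedFrobPolynomial v (fun w => X - C (ψ.valueAtUniformizer w)) ↔
      (qExpansion 1 ⇑f).coeff (Rat.HeightOneSpectrum.natGenerator v) =
          ∑ᶠ I ∈ {I : Ideal (𝓞 K) | Ideal.absNorm I = Rat.HeightOneSpectrum.natGenerator v},
            Literature.NumberTheory.LFunctions.idealPow K (fun w => ψ.valueAtUniformizer w) I ∧
        (nebentypus f (Rat.HeightOneSpectrum.natGenerator v : ZMod N) : ℂ) *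
            (Rat.HeightOneSpectrum.natGenerator v : ℂ) ^ (k - 1) =
          -Literature.NumberTheory.LFunctions.idealPow K (fun w => ψ.valueAtUniformizer w)
            (Ideal.span {((Rat.HeightOneSpectrum.natGenerator v : ℕ) : 𝓞 K)}) := by
  rw [map_heckePolynomial_eq_inducedFrobPolynomial_iff_of_singleton f ψ v hS hw,
    finsum_mem_setOf_absNorm_eq_of_singleton v hS hw,
    idealPow_span_natGenerator_of_singleton h2 _ v hS hw]

end RibetForm

/-! ### Assembly: the fact from Ribet's printed statement (Thm. (3.4), Cor. (3.5), Remark (3.5)) -/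

section Assembly

/-- **The fact follows from Ribet's printed statement.**  Hypothesis `H` is Theorem (3.4) with
Corollary (3.5) and Remark (3.5) of Ribet 1977, §3 (LNM 601, pp. 34–35), for `𝔪 = 𝔣` the conductor
of `ψ` and level `N = D · N(𝔣)`, written on `q`-expansion coefficients in the tree's vocabulary: for
`K` imaginary quadratic, `k ≥ 2` and `ψ` of infinity type `σ^{k-1}`, there is a newform
`f ∈ S_k(Γ₁(N))` (`IsNewform1`, "`g` is a newform if `𝔪` is the conductor of `ψ`", Remark (3.5)) whose
level is divisible by `|d_K|` and by every rational prime below a place where `ψ` ramifies (the level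
is `DM`, `M = N(𝔪)`, Thm. (3.4)), with `a_p(f) = ∑_{N𝔞 = p} ψ̃(𝔞)` for `p ∤ N` (Cor. (3.5):
"`a_p(f) = a_p` for all `p ∤ DM`", `a_p = c_p = ∑_{N𝔞 = p} ψ(𝔞)` by the definition of
`g = ∑ ψ(𝔞) q^{N𝔞}`) and character `ε = ηφ`, `η(p) p^{k-1} = ψ((p))`, `φ` the quadratic character of
`K` — i.e. `ε(p) p^{k-1} = ψ̃((p))` at a split and `= -ψ̃((p))` at an inert prime (§3, p. 34).  Here
`ψ̃(𝔞) = ∏_𝔭 ψ(ϖ_𝔭)^{v_𝔭(𝔞)}` (`idealPow`) is the ideal character of `ψ` away from `𝔣`.  The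
conclusion is `Ribet1977_cmNewform_of_heckeCharacter` verbatim: the fact is a faithful consequence of
the printed theorem, the passage being the bookkeeping of this file (`p ∤ N ⇒ e_p = 1`; a ramified
`w ∣ p` would give `p ∣ N`; split/inert dichotomy and the two Ribet-form Euler-factor lemmas).
[cite: Ribet1977Nebentypus, §3, Thm. (3.4), Cor. (3.5), Remark (3.5) (LNM 601, pp. 34–35)] -/
theorem Ribet1977_cmNewform_of_heckeCharacter_of_qExpansion
    (H : ∀ (K : Type) [Field K] [NumberField K], Module.finrank ℚ K = 2 → ¬ IsTotallyReal K →
      ∀ (k : ℕ), 2 ≤ k → ∀ (ψ : HeckeCharacter K),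
      (ψ.HasInfinityType (fun _ => (k : ℤ) - 1) (fun _ => 0) ∨
        ψ.HasInfinityType (fun _ => 0) (fun _ => (k : ℤ) - 1)) →
      ∃ (N : ℕ) (_ : NeZero N) (f : CuspForm (Gamma1 N) (k : ℤ)), IsNewform1 f ∧
        (NumberField.discr K).natAbs ∣ N ∧
        (∀ w : HeightOneSpectrum (𝓞 K), ¬ ψ.IsUnramifiedAt w →
          Rat.HeightOneSpectrum.natGenerator (w.under (𝓞 ℚ)) ∣ N) ∧
        ∀ v : HeightOneSpectrum (𝓞 ℚ), ¬ Rat.HeightOneSpectrum.natGenerator v ∣ N →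
          (qExpansion 1 ⇑f).coeff (Rat.HeightOneSpectrum.natGenerator v) =
              ∑ᶠ I ∈ {I : Ideal (𝓞 K) | Ideal.absNorm I = Rat.HeightOneSpectrum.natGenerator v},
                Literature.NumberTheory.LFunctions.idealPow K (fun w => ψ.valueAtUniformizer w) I ∧
          ((∃ w₁ w₂ : HeightOneSpectrum (𝓞 K), w₁ ≠ w₂ ∧
              w₁.asIdeal.under (𝓞 ℚ) = v.asIdeal ∧ w₂.asIdeal.under (𝓞 ℚ) = v.asIdeal) →
            (nebentypus f (Rat.HeightOneSpectrum.natGenerator v : ZMod N) : ℂ) *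
                (Rat.HeightOneSpectrum.natGenerator v : ℂ) ^ ((k : ℤ) - 1) =
              Literature.NumberTheory.LFunctions.idealPow K (fun w => ψ.valueAtUniformizer w)
                (Ideal.span {((Rat.HeightOneSpectrum.natGenerator v : ℕ) : 𝓞 K)})) ∧
          ((∃ w : HeightOneSpectrum (𝓞 K), w.asIdeal.under (𝓞 ℚ) = v.asIdeal ∧
              w.asIdeal.inertiaDeg (𝓞 ℚ) = 2) →
            (nebentypus f (Rat.HeightOneSpectrum.natGenerator v : ZMod N) : ℂ) *
                (Rat.HeightOneSpectrum.natGenerator v : ℂ) ^ ((k : ℤ) - 1) =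
              -Literature.NumberTheory.LFunctions.idealPow K (fun w => ψ.valueAtUniformizer w)
                (Ideal.span {((Rat.HeightOneSpectrum.natGenerator v : ℕ) : 𝓞 K)}))) :
    Ribet1977_cmNewform_of_heckeCharacter := by
  intro K _ _ hK hKi k hk ψ hψ
  obtain ⟨N, hN, f, hf, hD, hram, hv⟩ := H K hK hKi k hk ψ hψ
  refine ⟨N, hN, f, hf, fun v hpv => ?_⟩
  have hp : ((Rat.HeightOneSpectrum.primesEquiv v : Nat.Primes) : ℕ) =
      Rat.HeightOneSpectrum.natGenerator v := rfl
  rw [hp] at hpv ⊢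
  have he : v.asIdeal.ramificationIdxIn (𝓞 K) = 1 :=
    ramificationIdxIn_eq_one_of_not_dvd_level K v hD hpv
  refine ⟨he, fun w hw => ?_, ?_⟩
  · -- a ramified `w ∣ v` would force `p_v ∣ N`
    by_contra hr
    have hwv : w.under (𝓞 ℚ) = v :=
      HeightOneSpectrum.ext (by rw [HeightOneSpectrum.under_asIdeal]; exact hw)
    exact hpv (hwv ▸ hram w hr)
  · obtain ⟨ha, hsplit, hinert⟩ := hv v hpv
    rcases exists_places_eq_pair_or_eq_singleton hK v he with
      ⟨w₁, w₂, hne, hS, h₁, h₂⟩ | ⟨w, hS, hw⟩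
    · rw [map_heckePolynomial_eq_inducedFrobPolynomial_iff_ribet_of_pair hK f ψ v hne hS h₁ h₂]
      have hm₁ : w₁ ∈ {w : HeightOneSpectrum (𝓞 K) | w.asIdeal.under (𝓞 ℚ) = v.asIdeal} := by
        rw [hS]; exact Set.mem_insert _ _
      have hm₂ : w₂ ∈ {w : HeightOneSpectrum (𝓞 K) | w.asIdeal.under (𝓞 ℚ) = v.asIdeal} := by
        rw [hS]; exact Set.mem_insert_of_mem _ rfl
      exact ⟨ha, hsplit ⟨w₁, w₂, hne, hm₁, hm₂⟩⟩
    · rw [map_heckePolynomial_eq_inducedFrobPolynomial_iff_ribet_of_singleton hK f ψ v hS hw]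
      have hm : w ∈ {w : HeightOneSpectrum (𝓞 K) | w.asIdeal.under (𝓞 ℚ) = v.asIdeal} := by
        rw [hS]; exact Set.mem_singleton _
      exact ⟨ha, hinert ⟨w, hm, hw⟩⟩

end Assembly

end Literature.NumberTheory.EllipticCurves.ModularForms

end
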